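import Literature.Analysis.FunctionSpaces.TorusCalculusProofs
import HarnessLib

/-!
# Stub `stub_pinnedSeparatrixFlux` of the line `SketchIdeator2` (card `separatrix-flux-pinning`)
# (crux stmt-AnomalousDissipation-14249, `MarginalStabilityChain.ChainRealisation`)

The stationary, purely two-dimensional step of the chain: the **Rhines–Young integral constraint
with a source** for the `x₂`-averaged axial momentum.  On the flat torus `T²` let `W` be the mean
axial velocity, `V = ∇⊥Ψ` the mean planar velocity (`V₀ = ∂₁Ψ`, `V₁ = -∂₀Ψ`), `T` the eddy flux of
axial momentum and `h` the axial source, all smooth, satisfying the weak stationary balance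
`∫ (W ⟪V, ∇ψ⟫ + ⟪T, ∇ψ⟫ + ν W Δψ + h ψ) = 0` for every smooth test function `ψ`.  Then for every
smooth `G : ℝ → ℝ`
`∫ G'(Ψ) ⟪T, ∇Ψ⟫ = -∫ h G(Ψ) - ν ∫ W Δ(G ∘ Ψ)`:
the advective flux across the level sets of `Ψ` drops out.

Proof: test the balance with `ψ := G ∘ Ψ` (smooth), use the chain rule
`D(G ∘ Ψ)(x) = G'(Ψ x) • DΨ(x)` on the torus (through the re-centred lift, Mathlib
`HasDerivAt.comp_hasFDerivAt`), so that `⟪w, ∇(G∘Ψ)(x)⟫ = G'(Ψ x) ⟪w, ∇Ψ(x)⟫`, and the pointwise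
identity `⟪∇⊥Ψ, ∇Ψ⟫ = ∂₁Ψ ∂₀Ψ - ∂₀Ψ ∂₁Ψ = 0`; then split the integral (all integrands are
continuous on the compact torus).

References: P. B. Rhines and W. R. Young, *Homogenization of potential vorticity in planetary
gyres*, J. Fluid Mech. 122 (1982), §2 (the integral constraint around closed streamlines); the
torus calculus of `Literature/Analysis/FunctionSpaces/TorusCalculus(Proofs).lean`.
-/

-- `Summit.<Summit>.<Problem>` is the tree's mandated summit-side namespace (CONVENTIONS §2); for
-- this single-conjunct summit the two coincide, so the duplicate is deliberate.
set_option linter.dupNamespace false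

noncomputable section

open MeasureTheory Set Filter Topology
open scoped InnerProductSpace
open Literature.Analysis.FunctionSpaces Literature.Analysis.FunctionSpaces.Torus

namespace Summit.AnomalousDissipation.AnomalousDissipation.Theorems.ChainRealisation.SeparatrixFluxPinning

/-- Local notation: the planar torus `T²` (as in the line skeleton, so that the stub statement below
is the registered signature verbatim). -/
local notation "𝕋²" => UnitAddTorus (Fin 2)
/-- Local notation: planar velocity values (as in the line skeleton). -/
local notation "E²" => EuclideanSpace ℝ (Fin 2)

/-! ## Chain rule on the torus for post-composition with a scalar function -/

/-- Post-composition of a smooth torus function with a smooth real function is smooth: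
the lift of `G ∘ Ψ` is `G ∘ lift Ψ`. [folklore] -/
theorem isSmooth_comp {G : ℝ → ℝ} {Ψ : 𝕋² → ℝ} (hG : ContDiff ℝ (⊤ : ℕ∞) G) (hΨ : IsSmooth Ψ) :
    IsSmooth (G ∘ Ψ) :=
  hG.comp hΨ

/-- Chain rule for the torus derivative: `D(G ∘ Ψ)(x) w = G'(Ψ x) * DΨ(x) w` for differentiable
`G` and `C¹` `Ψ` (the re-centred lift of `G ∘ Ψ` is `G ∘ liftAt Ψ x`; Mathlib
`HasDerivAt.comp_hasFDerivAt`). [folklore] -/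
theorem fderiv_comp_apply {G : ℝ → ℝ} {Ψ : 𝕋² → ℝ} (hG : Differentiable ℝ G)
    (hΨ : IsContDiff 1 Ψ) (x : 𝕋²) (w : E²) :
    Torus.fderiv (G ∘ Ψ) x w = deriv G (Ψ x) * Torus.fderiv Ψ x w := by
  have hd : DifferentiableAt ℝ (liftAt Ψ x) 0 :=
    ((hΨ.liftAt x).differentiable one_ne_zero).differentiableAt
  have h0 : liftAt Ψ x 0 = Ψ x := liftAt_apply_zero Ψ x
  have hGd : HasDerivAt G (deriv G (Ψ x)) (liftAt Ψ x 0) := by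
    rw [h0]
    exact (hG _).hasDerivAt
  have hlift : liftAt (G ∘ Ψ) x = G ∘ liftAt Ψ x := rfl
  have hcomp := hGd.comp_hasFDerivAt (0 : E²) hd.hasFDerivAt
  rw [Torus.fderiv, hlift, hcomp.fderiv, smul_apply, smul_eq_mul]
  rfl

/-- Chain rule for the torus gradient, tested against a vector:
`⟪w, ∇(G ∘ Ψ)(x)⟫ = G'(Ψ x) * ⟪w, ∇Ψ(x)⟫`. [folklore] -/
theorem inner_gradient_comp {G : ℝ → ℝ} {Ψ : 𝕋² → ℝ} (hG : Differentiable ℝ G)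
    (hΨ : IsContDiff 1 Ψ) (x : 𝕋²) (w : E²) :
    ⟪w, gradient (G ∘ Ψ) x⟫_ℝ = deriv G (Ψ x) * ⟪w, gradient Ψ x⟫_ℝ := by
  rw [← real_inner_comm, Torus.inner_gradient_left, fderiv_comp_apply hG hΨ,
    ← real_inner_comm w, Torus.inner_gradient_left]

/-- The planar velocity `V = ∇⊥Ψ` is tangent to the level sets of `Ψ`: `⟪V x, ∇Ψ(x)⟫ = 0`
(`DΨ(x) V = V₀ ∂₀Ψ + V₁ ∂₁Ψ = ∂₁Ψ ∂₀Ψ - ∂₀Ψ ∂₁Ψ`). [folklore] -/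
theorem inner_perp_gradient_eq_zero {Ψ : 𝕋² → ℝ} {V : 𝕋² → E²} (hΨ : IsContDiff 1 Ψ)
    (hV : ∀ x, V x 0 = partialDeriv 1 Ψ x ∧ V x 1 = -partialDeriv 0 Ψ x) (x : 𝕋²) :
    ⟪V x, gradient Ψ x⟫_ℝ = 0 := by
  rw [← real_inner_comm, Torus.inner_gradient_left, fderiv_apply_eq_sum_partialDeriv hΨ,
    Fin.sum_univ_two, (hV x).1, (hV x).2, smul_eq_mul, smul_eq_mul]
  ring

/-! ## The pinned separatrix flux identity -/

/-- **Rhines–Young constraint with source, for axial momentum** (stub `stub_pinnedSeparatrixFlux`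
of the line skeleton, verbatim).  Stationary mean objects on `T²`: mean axial velocity `W`, mean
planar velocity `V = ∇⊥Ψ`, total eddy flux `T` of axial momentum, axial source `h`, with the weak
stationary balance `∫ (W V + T)·∇ψ + ν W Δψ + h ψ = 0` for all smooth `ψ`.  Then for every smooth
`G : ℝ → ℝ` the advective flux across the level sets of `Ψ` drops out (`V·∇Ψ = 0` pointwise) and
`∫ G'(Ψ) T·∇Ψ = -∫ h·G(Ψ) - ν ∫ W Δ(G∘Ψ)` (test with `ψ = G ∘ Ψ`).  Source: Rhines–Young 1982,
§2 (integral constraint around closed streamlines, here in weak form with a source term). -/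
theorem stub_pinnedSeparatrixFlux :
    ∀ (ν : ℝ) (h W Ψ : 𝕋² → ℝ) (V T : 𝕋² → E²),
      IsSmooth h → IsSmooth W → IsSmooth Ψ → IsSmooth V → IsSmooth T →
      (∀ x, V x 0 = partialDeriv 1 Ψ x ∧ V x 1 = -partialDeriv 0 Ψ x) →
      (∀ ψ : 𝕋² → ℝ, IsSmooth ψ →
        ∫ x, (W x * ⟪V x, gradient ψ x⟫_ℝ + ⟪T x, gradient ψ x⟫_ℝ + ν * (W x * laplacian ψ x) +
          h x * ψ x) = 0) →
      ∀ G : ℝ → ℝ, ContDiff ℝ (⊤ : ℕ∞) G →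
        ∫ x, deriv G (Ψ x) * ⟪T x, gradient Ψ x⟫_ℝ =
          -(∫ x, h x * G (Ψ x)) - ν * ∫ x, W x * laplacian (G ∘ Ψ) x := by
  intro ν h W Ψ V T hh hW hΨ _hV hT hVΨ hweak G hG
  have hGΨ : IsSmooth (G ∘ Ψ) := isSmooth_comp hG hΨ
  have hΨ1 : IsContDiff 1 Ψ := hΨ.isContDiff (by simp)
  have hGd : Differentiable ℝ G := hG.differentiable (by simp)
  -- the tested balance, with the integrand simplified pointwise
  have hpt : (fun x => W x * ⟪V x, gradient (G ∘ Ψ) x⟫_ℝ + ⟪T x, gradient (G ∘ Ψ) x⟫_ℝ +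
        ν * (W x * laplacian (G ∘ Ψ) x) + h x * (G ∘ Ψ) x) =
      fun x => deriv G (Ψ x) * ⟪T x, gradient Ψ x⟫_ℝ +
        (ν * (W x * laplacian (G ∘ Ψ) x) + h x * G (Ψ x)) := by
    funext x
    rw [inner_gradient_comp hGd hΨ1 x (V x), inner_gradient_comp hGd hΨ1 x (T x),
      inner_perp_gradient_eq_zero hΨ1 hVΨ x, mul_zero, mul_zero, zero_add, Function.comp_apply,
      add_assoc]
  have hbal := hweak (G ∘ Ψ) hGΨ
  rw [hpt] at hbal
  -- integrability of the three pieces (continuous functions on the compact torus)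
  have hcG' : Continuous fun x => deriv G (Ψ x) :=
    (hG.continuous_deriv (by simp)).comp hΨ.continuous
  have hiA : Integrable (fun x => deriv G (Ψ x) * ⟪T x, gradient Ψ x⟫_ℝ) :=
    (hcG'.mul (hT.inner hΨ.gradient).continuous).integrable_unitAddTorus
  have hiB : Integrable (fun x => ν * (W x * laplacian (G ∘ Ψ) x)) :=
    (continuous_const.mul (hW.continuous.mul hGΨ.laplacian.continuous)).integrable_unitAddTorus
  have hiC : Integrable (fun x => h x * G (Ψ x)) :=
    (hh.continuous.mul (hG.continuous.comp hΨ.continuous)).integrable_unitAddTorus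
  rw [integral_add hiA (hiB.fun_add hiC), integral_add hiB hiC, integral_const_mul] at hbal
  linarith

end Summit.AnomalousDissipation.AnomalousDissipation.Theorems.ChainRealisation.SeparatrixFluxPinning

end
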